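import Literature.NumberTheory.Automorphic.JacquetRayFitting                       -- ★ p832364 (R2): `heckeRayEnd`, `fixedPointsMk`, `exists_heckeRayEnd_eigenvector_of_jacquet`, `fixedPointsMk_ne_zero_of_eigenvector`, `range_fixedPointsMk_eq`
import Literature.NumberTheory.Automorphic.UnitaryGroupPrincipalSeriesExponents   -- ★ `Representation.HasJacquetExponent`
import Mathlib.LinearAlgebra.Eigenspace.Triangularizable
import HarnessLib

/-!
# Exponents of the Jacquet module ↔ non-zero eigenvalues of the Hecke ray operator `T_a` on `V^K` (abelian Levi; rank-one kit R2b)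

Topic `NumberTheory/Automorphic`; namespace `Representation` (sequel of ★ R1 `JacquetRayHeckeOperator`, ★ R2 `JacquetRayFitting`).  THEOREMS ONLY
(no definition, no named fact, no instance, no `sorry`).  Cell `hodgecm-mathlib`, F0∕P3, seat F0P3-p01 (g10): file (R2b) of the rank-one road to ★
`UnitaryGroup.U3SquareIntegrableExponents` [Casselman1995, Thm. 4.4.6] — the dictionary between Casselman's statement («for every exponent `χ'`
of `r_P(π)`, `|χ'(a)| < 1`») and the generic criterion ★ `CasselmanCriterionRankOne` («every eigenvalue `c` of `T_a` on `V^{K_n}` has `‖c‖² D < 1`»).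

SETTING as in R1∕R2 (`ρ` admissible over `ℂ`, `t = (P, M, N)` with `N` closed, an Iwahori datum `𝓘` — levels `K_n = 𝓘.K n` with
`K_n = (K_n ∩ N̄)(K_n ∩ M)(K_n ∩ N)` —, `a ∈ M` dominant with `⋃ₘ a⁻ᵐ (K_n ∩ N) aᵐ = N`), plus: **`M` is ABELIAN** (the Levi of a Borel: a torus)
and `P` locally compact (for `δ_P`).  Recall `normalizedJacquet = jacquetModule ⊗ δ_P^{-1/2}` (★ `normalizedJacquet`), so an exponent `χ'` with
eigenvector `w` has `π_N(a) w = δ_P(a)^{1/2} χ'(a) · w`.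

RESULTS.
* §1 `exists_character_of_forall_mem_of_comm` — an abelian group acting on a finite-dimensional complex space and preserving a non-zero
  subspace `E` has a common eigenvector in `E`, i.e. a character `χ : M →* ℂˣ` and `0 ≠ w ∈ E` with `τ m w = χ m • w` (minimal invariant
  subspace + one eigenvalue per operator). [folklore; cite: Casselman1995, Prop. 2.1.9]
* §2 `exists_hasEigenvalue_heckeRayEnd_of_hasJacquetExponent` — **exponent ⇒ eigenvalue**: if `χ'` is an exponent then for some level `n`,
  `δ_P(a)^{1/2} χ'(a)` is an eigenvalue of `T_a` on `V^{K_n}` (the eigenvector is smooth in `V_N`, hence in `V_N^{K_n ∩ M} = [V^{K_n}]` by ★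
  `range_fixedPointsMk_eq`; lift by ★ `exists_heckeRayEnd_eigenvector_of_jacquet`). [cite: Casselman1995, Prop. 4.1.4, Prop. 4.1.6, §4.4]
* §3 `exists_hasJacquetExponent_of_hasEigenvalue_heckeRayEnd` — **eigenvalue ⇒ exponent**: a NON-ZERO eigenvalue `c` of `T_a` on `V^{K_n}` is
  `δ_P(a)^{1/2} χ'(a)` for some exponent `χ'` (★ `fixedPointsMk_ne_zero_of_eigenvector` gives a `π_N(a)`-eigenvector `w ∈ [V^{K_n}]` of eigenvalue `c`;
  the `c`-eigenspace of `π_N(a)` in the finite-dimensional `[V^{K_n}]` is `M`-stable since `M` is abelian; §1). [cite: Casselman1995, §4.4 p. 45]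

## References
* [Casselman1995] W. Casselman, *Introduction to the theory of admissible representations of `p`-adic reductive groups* (draft 1 May 1995),
  Prop. 2.1.9, §4.1, §4.4 (exponents; Thm. 4.4.6).
* [BernsteinZelevinsky1977] I. N. Bernstein, A. V. Zelevinsky, Ann. Sci. ÉNS 10 (1977), §2.3 (normalised functors), Cor. 2.13.
-/

set_option autoImplicit false

open scoped BigOperators Pointwise
open Literature.NumberTheory.Automorphic

namespace Representation

/-! ## §1 A common eigenvector for an abelian group on an invariant subspace -/

section CommonEigenvector

variable {M W : Type*} [Group M] [AddCommGroup W] [Module ℂ W]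

/-- **A common eigenvector of an abelian group in an invariant finite-dimensional non-zero subspace**: `∃ χ : M →* ℂˣ`, `0 ≠ w ∈ E`,
`τ m w = χ(m) w` for all `m`.  Proof: an invariant subspace `E₀ ≤ E` of minimal positive dimension; each `τ(m)|E₀` has an eigenvalue, whose
eigenspace is invariant (commutativity), hence all of `E₀`. [cite: Casselman1995, Prop. 2.1.9] -/
theorem exists_character_of_forall_mem_of_comm [FiniteDimensional ℂ W] (τ : Representation ℂ M W) (hM : ∀ a b : M, a * b = b * a)
    (E : Submodule ℂ W) (hE : E ≠ ⊥) (hEinv : ∀ m : M, ∀ w ∈ E, τ m w ∈ E) :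
    ∃ χ : M →* ℂˣ, ∃ w ∈ E, w ≠ 0 ∧ ∀ m : M, τ m w = ((χ m : ℂˣ) : ℂ) • w := by
  classical
  -- invariant non-zero subspaces of `E`, by dimension
  let P : ℕ → Prop := fun d => ∃ E' : Submodule ℂ W, E' ≤ E ∧ E' ≠ ⊥ ∧ (∀ m : M, ∀ w ∈ E', τ m w ∈ E') ∧ Module.finrank ℂ E' = d
  have hP : ∃ d, P d := ⟨_, E, le_rfl, hE, hEinv, rfl⟩
  obtain ⟨E₀, hE₀E, hE₀ne, hE₀inv, hE₀d⟩ := Nat.find_spec hP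
  have hmin : ∀ E' : Submodule ℂ W, E' ≤ E → E' ≠ ⊥ → (∀ m : M, ∀ w ∈ E', τ m w ∈ E') →
      Module.finrank ℂ E₀ ≤ Module.finrank ℂ E' := by
    intro E' h1 h2 h3
    rw [hE₀d]
    exact Nat.find_min' hP ⟨E', h1, h2, h3, rfl⟩
  -- each `τ m` acts on `E₀` by a scalar
  have hscalar : ∀ m : M, ∃ c : ℂ, ∀ w ∈ E₀, τ m w = c • w := by
    intro m
    -- the restriction of `τ m` to `E₀` and one of its eigenvalues
    let f : Module.End ℂ E₀ := (τ m).restrict (p := E₀) (fun w hw => hE₀inv m w hw)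
    haveI : Nontrivial E₀ := Submodule.nontrivial_iff_ne_bot.2 hE₀ne
    obtain ⟨c, hc⟩ := Module.End.exists_eigenvalue f
    refine ⟨c, ?_⟩
    -- the `c`-eigenspace of `τ m` inside `E₀`, an invariant non-zero subspace
    let E₁ : Submodule ℂ W :=
      { carrier := {w | w ∈ E₀ ∧ τ m w = c • w}
        zero_mem' := ⟨E₀.zero_mem, by rw [map_zero, smul_zero]⟩
        add_mem' := fun {x y} hx hy => ⟨E₀.add_mem hx.1 hy.1, by rw [map_add, hx.2, hy.2, smul_add]⟩
        smul_mem' := fun r {x} hx => ⟨E₀.smul_mem r hx.1, by rw [map_smul, hx.2, smul_comm]⟩ }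
    have hE₁le : E₁ ≤ E₀ := fun w hw => hw.1
    have hE₁ne : E₁ ≠ ⊥ := by
      obtain ⟨v, hv⟩ := hc.exists_hasEigenvector
      have hv1 : f v = c • v := hv.apply_eq_smul
      have hv2 : (v : W) ≠ 0 := fun h => hv.2 (Subtype.ext h)
      rw [Submodule.ne_bot_iff]
      refine ⟨(v : W), ⟨v.2, ?_⟩, hv2⟩
      have := congrArg Subtype.val hv1
      simpa [f, LinearMap.restrict_apply] using this
    have hE₁inv : ∀ m' : M, ∀ w ∈ E₁, τ m' w ∈ E₁ := by
      intro m' w hw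
      refine ⟨hE₀inv m' w hw.1, ?_⟩
      rw [← Module.End.mul_apply, ← map_mul, hM, map_mul, Module.End.mul_apply, hw.2, map_smul]
    have hEq : E₁ = E₀ :=
      Submodule.eq_of_le_of_finrank_le hE₁le (hmin E₁ (hE₁le.trans hE₀E) hE₁ne hE₁inv)
    intro w hw
    rw [← hEq] at hw
    exact hw.2
  choose c hc using hscalar
  -- a non-zero vector of `E₀` and the character
  obtain ⟨w₀, hw₀E, hw₀⟩ := Submodule.ne_bot_iff _ |>.1 hE₀ne
  have hc_ne : ∀ m : M, c m ≠ 0 := by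
    intro m h0
    apply hw₀
    have h1 : τ m⁻¹ (τ m w₀) = w₀ := by rw [← Module.End.mul_apply, ← map_mul, inv_mul_cancel, map_one, Module.End.one_apply]
    rw [hc m w₀ hw₀E, h0, zero_smul, map_zero] at h1
    exact h1.symm
  have hc_mul : ∀ m m' : M, c (m * m') = c m * c m' := by
    intro m m'
    have h1 : τ (m * m') w₀ = (c m * c m') • w₀ := by
      rw [map_mul, Module.End.mul_apply, hc m' w₀ hw₀E, map_smul, hc m w₀ hw₀E, smul_smul, mul_comm]
    rw [hc (m * m') w₀ hw₀E] at h1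
    exact smul_left_injective ℂ hw₀ h1
  have hc_one : c 1 = 1 := by
    have h1 : τ 1 w₀ = w₀ := by rw [map_one, Module.End.one_apply]
    rw [hc 1 w₀ hw₀E] at h1
    have : c 1 • w₀ = (1 : ℂ) • w₀ := by rw [h1, one_smul]
    exact smul_left_injective ℂ hw₀ this
  let χ : M →* ℂˣ :=
    { toFun := fun m => Units.mk0 (c m) (hc_ne m)
      map_one' := Units.ext hc_one
      map_mul' := fun m m' => Units.ext (hc_mul m m') }
  exact ⟨χ, w₀, hE₀E hw₀E, hw₀, fun m => hc m w₀ hw₀E⟩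

end CommonEigenvector

/-! ## §2 Exponents give eigenvalues of `T_a` -/

section Exponents

variable {G V : Type*} [Group G] [TopologicalSpace G] [IsTopologicalGroup G] [AddCommGroup V] [Module ℂ V]
  {ρ : Representation ℂ G V}

/-- The normalised Jacquet action in terms of the plain one: `r_P(m) w = δ_P(m)^{-1/2} · π_N(m) w`. [cite: BernsteinZelevinsky1977, §2.3] -/
theorem normalizedJacquet_apply (t : ParabolicTriple G) [LocallyCompactSpace ↥t.P] (m : ↥t.M) (w : (t.restrict ρ).Coinvariants) :
    ρ.normalizedJacquet t m w = (((rootDeltaChar t.P (Subgroup.inclusion t.M_le m))⁻¹ : ℂˣ) : ℂ) • ρ.jacquetModule t m w := by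
  show (((((rootDeltaChar t.P)⁻¹.comp (Subgroup.inclusion t.M_le)) m : ℂˣ) : ℂ)) • ρ.jacquetModule t m w = _
  rw [MonoidHom.comp_apply, MonoidHom.inv_apply]

/-- An eigenvector of the normalised Jacquet action with eigencharacter `χ'` is an eigenvector of `π_N(m)` with eigenvalue
`δ_P(m)^{1/2} χ'(m)`. [cite: Casselman1995, §4.4 p. 45] -/
theorem jacquetModule_apply_eq_smul_of_normalizedJacquet (t : ParabolicTriple G) [LocallyCompactSpace ↥t.P] {χ' : ↥t.M →* ℂˣ}
    {w : (t.restrict ρ).Coinvariants} (hw : ∀ m : ↥t.M, ρ.normalizedJacquet t m w = ((χ' m : ℂˣ) : ℂ) • w) (m : ↥t.M) :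
    ρ.jacquetModule t m w = (((rootDeltaChar t.P (Subgroup.inclusion t.M_le m) : ℂˣ) : ℂ) * ((χ' m : ℂˣ) : ℂ)) • w := by
  have h := hw m
  rw [normalizedJacquet_apply] at h
  rw [mul_smul, ← h, smul_smul, Units.mul_inv, one_smul]

/-- **EXPONENT ⇒ EIGENVALUE OF `T_a`**: if `χ'` is an exponent of `ρ` (★ `HasJacquetExponent`) then for some level `K_n` of the Iwahori datum,
`δ_P(a)^{1/2} χ'(a)` is an eigenvalue of the Hecke ray operator `T_a` on `V^{K_n}`. [cite: Casselman1995, Prop. 4.1.4, Prop. 4.1.6, §4.4 p. 45] -/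
theorem exists_hasEigenvalue_heckeRayEnd_of_hasJacquetExponent (t : ParabolicTriple G) [LocallyCompactSpace ↥t.P] (𝓘 : t.IwahoriDatum)
    (hN : IsClosed (t.N : Set G)) (hρa : ρ.IsAdmissible)
    (haN : ∀ n, ∀ x ∈ 𝓘.K n ⊓ t.N, 𝓘.a * x * 𝓘.a⁻¹ ∈ 𝓘.K n)
    (haNbar : ∀ n, ∀ x ∈ 𝓘.K n ⊓ 𝓘.Nbar, 𝓘.a⁻¹ * x * 𝓘.a ∈ 𝓘.K n ⊓ 𝓘.Nbar)
    (hexh : ∀ n, ∀ x ∈ t.N, ∃ m : ℕ, ∀ m', m ≤ m' → 𝓘.a ^ m' * x * (𝓘.a ^ m')⁻¹ ∈ 𝓘.K n)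
    {χ' : ↥t.M →* ℂˣ} (hχ : ρ.HasJacquetExponent t χ') :
    ∃ n : ℕ, Module.End.HasEigenvalue (ρ.heckeRayEnd (𝓘.isCompact_K n) hρa.1 𝓘.a)
      (((rootDeltaChar t.P ⟨𝓘.a, t.M_le 𝓘.a_mem⟩ : ℂˣ) : ℂ) * ((χ' ⟨𝓘.a, 𝓘.a_mem⟩ : ℂˣ) : ℂ)) := by
  obtain ⟨w, hw0, hw⟩ := hχ
  -- `w` is smooth in `V_N`, hence fixed by some `K_n ∩ M`
  have hsm : (ρ.jacquetModule t).IsSmoothVector w := isSmooth_jacquetModule ρ t hρa.1 w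
  obtain ⟨U, hUo, hU⟩ : ∃ U : Set G, IsOpen U ∧ Subtype.val ⁻¹' U = ((ρ.jacquetModule t).stabilizerSubgroup w : Set ↥t.M) :=
    isOpen_induced_iff.1 hsm
  have hU1 : U ∈ nhds (1 : G) := by
    refine hUo.mem_nhds ?_
    have : ((1 : ↥t.M) : G) ∈ U := by
      show (1 : ↥t.M) ∈ Subtype.val ⁻¹' U
      rw [hU]
      exact ((ρ.jacquetModule t).stabilizerSubgroup w).one_mem
    exact this
  obtain ⟨n, hn⟩ := 𝓘.hasBasis_K U hU1
  refine ⟨n, ?_⟩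
  -- `w ∈ V_N^{K_n ∩ M} = [V^{K_n}]`
  have hwfix : w ∈ (ρ.jacquetModule t).fixedPoints ((𝓘.K n).comap t.M.subtype) := by
    rw [mem_fixedPoints]
    intro m hm
    have hmU : (m : G) ∈ U := hn (Subgroup.mem_comap.1 hm)
    have : m ∈ ((ρ.jacquetModule t).stabilizerSubgroup w : Set ↥t.M) := by rw [← hU]; exact hmU
    exact ((ρ.jacquetModule t).mem_stabilizerSubgroup w m).1 this
  rw [← range_fixedPointsMk_eq t 𝓘 hρa n] at hwfix
  -- lift
  obtain ⟨v, hv0, hTv, -⟩ := exists_heckeRayEnd_eigenvector_of_jacquet t (𝓘.isCompact_K n) (𝓘.isOpen_K n) hN hρa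
    (𝓘.factorization n) 𝓘.a_mem (fun m hm => 𝓘.a_comm m (Subgroup.mem_inf.1 hm).2) (haN n) (haNbar n) (hexh n) hwfix hw0
    (jacquetModule_apply_eq_smul_of_normalizedJacquet t hw ⟨𝓘.a, 𝓘.a_mem⟩)
  exact Module.End.hasEigenvalue_of_hasEigenvector ⟨Module.End.mem_eigenspace_iff.2 hTv, hv0⟩

/-! ## §3 Non-zero eigenvalues of `T_a` give exponents (abelian `M`) -/

/-- **EIGENVALUE OF `T_a` ⇒ EXPONENT** (`M` abelian): a NON-ZERO eigenvalue `c` of `T_a` on `V^{K_n}` is `δ_P(a)^{1/2} χ'(a)` for some exponent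
`χ'` of `ρ`.  The class of an eigenvector is a `π_N(a)`-eigenvector in the finite-dimensional `[V^{K_n}]` (★ `fixedPointsMk_ne_zero_of_eigenvector`);
the `c`-eigenspace of `π_N(a)` there is `M`-stable (`M` abelian, `K_n ∩ M`-fixedness is preserved), so it contains a common eigenvector (§1).
[cite: Casselman1995, §4.4 p. 45, Prop. 2.1.9] -/
theorem exists_hasJacquetExponent_of_hasEigenvalue_heckeRayEnd (t : ParabolicTriple G) [LocallyCompactSpace ↥t.P] (𝓘 : t.IwahoriDatum)
    (hN : IsClosed (t.N : Set G)) (hρa : ρ.IsAdmissible) (hMc : ∀ a b : ↥t.M, a * b = b * a)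
    (haN : ∀ n, ∀ x ∈ 𝓘.K n ⊓ t.N, 𝓘.a * x * 𝓘.a⁻¹ ∈ 𝓘.K n)
    (haNbar : ∀ n, ∀ x ∈ 𝓘.K n ⊓ 𝓘.Nbar, 𝓘.a⁻¹ * x * 𝓘.a ∈ 𝓘.K n ⊓ 𝓘.Nbar)
    (hexh : ∀ n, ∀ x ∈ t.N, ∃ m : ℕ, ∀ m', m ≤ m' → 𝓘.a ^ m' * x * (𝓘.a ^ m')⁻¹ ∈ 𝓘.K n)
    (n : ℕ) {c : ℂ} (hc0 : c ≠ 0) (hc : Module.End.HasEigenvalue (ρ.heckeRayEnd (𝓘.isCompact_K n) hρa.1 𝓘.a) c) :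
    ∃ χ' : ↥t.M →* ℂˣ, ρ.HasJacquetExponent t χ' ∧
      ((rootDeltaChar t.P ⟨𝓘.a, t.M_le 𝓘.a_mem⟩ : ℂˣ) : ℂ) * ((χ' ⟨𝓘.a, 𝓘.a_mem⟩ : ℂˣ) : ℂ) = c := by
  classical
  obtain ⟨v, hv⟩ := hc.exists_hasEigenvector
  obtain ⟨hw0, hw⟩ := fixedPointsMk_ne_zero_of_eigenvector t (𝓘.isCompact_K n) (𝓘.isOpen_K n) hN hρa.1 (𝓘.factorization n)
    𝓘.a_mem (fun m hm => 𝓘.a_comm m (Subgroup.mem_inf.1 hm).2) (haN n) (haNbar n) (hexh n) hv.2 hc0 hv.apply_eq_smul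
  -- the finite-dimensional `[V^{K_n}]` and the `c`-eigenspace of `π_N(a)` in it
  haveI : FiniteDimensional ℂ (ρ.fixedPoints (𝓘.K n)) := finite_fixedPoints_of_isAdmissible hρa (𝓘.isCompact_K n) (𝓘.isOpen_K n)
  let R : Submodule ℂ (t.restrict ρ).Coinvariants := LinearMap.range (ρ.fixedPointsMk t (𝓘.K n))
  haveI : FiniteDimensional ℂ R := inferInstance
  set a' : ↥t.M := ⟨𝓘.a, 𝓘.a_mem⟩ with ha'
  -- work inside the finite-dimensional space `R` with the restricted action
  have hReq : R = (ρ.jacquetModule t).fixedPoints ((𝓘.K n).comap t.M.subtype) := range_fixedPointsMk_eq t 𝓘 hρa n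
  have hRinv : ∀ m : ↥t.M, ∀ x ∈ R, ρ.jacquetModule t m x ∈ R := by
    intro m x hx
    rw [hReq, mem_fixedPoints] at hx ⊢
    intro κ hκ
    rw [← Module.End.mul_apply, ← map_mul, hMc, map_mul, Module.End.mul_apply, hx κ hκ]
  let τ : Representation ℂ ↥t.M R :=
    { toFun := fun m => (ρ.jacquetModule t m).restrict (hRinv m)
      map_one' := by ext x; simp [LinearMap.restrict_apply]
      map_mul' := fun m m' => by ext x; simp [LinearMap.restrict_apply] }
  have hτ : ∀ (m : ↥t.M) (x : R), ((τ m x : R) : (t.restrict ρ).Coinvariants) = ρ.jacquetModule t m x := fun m x => rfl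
  let E : Submodule ℂ R :=
    { carrier := {x | ρ.jacquetModule t a' (x : (t.restrict ρ).Coinvariants) = c • (x : (t.restrict ρ).Coinvariants)}
      zero_mem' := by simp
      add_mem' := fun {x y} hx hy => by
        simp only [Set.mem_setOf_eq, Submodule.coe_add, map_add, smul_add] at hx hy ⊢; rw [hx, hy]
      smul_mem' := fun r {x} hx => by
        simp only [Set.mem_setOf_eq, Submodule.coe_smul, map_smul] at hx ⊢; rw [hx, smul_comm] }
  have hEmem : ∀ x : R, x ∈ E ↔ ρ.jacquetModule t a' (x : (t.restrict ρ).Coinvariants) = c • (x : (t.restrict ρ).Coinvariants) :=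
    fun x => Iff.rfl
  have hE : E ≠ ⊥ := by
    rw [Submodule.ne_bot_iff]
    refine ⟨⟨ρ.fixedPointsMk t (𝓘.K n) v, LinearMap.mem_range_self _ _⟩, (hEmem _).2 hw, fun h => hw0 ?_⟩
    exact congrArg Subtype.val h
  have hEinv : ∀ m : ↥t.M, ∀ x ∈ E, τ m x ∈ E := by
    intro m x hx
    rw [hEmem] at hx ⊢
    rw [hτ, ← Module.End.mul_apply, ← map_mul, hMc, map_mul, Module.End.mul_apply, hx, map_smul]
  obtain ⟨χ, x, hxE, hx0, hχ⟩ := exists_character_of_forall_mem_of_comm τ hMc E hE hEinv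
  -- the normalised character
  let χ' : ↥t.M →* ℂˣ := χ * ((rootDeltaChar t.P)⁻¹.comp (Subgroup.inclusion t.M_le))
  have hx0' : (x : (t.restrict ρ).Coinvariants) ≠ 0 := fun h => hx0 (Subtype.ext h)
  have hχ_apply : ∀ m : ↥t.M, ρ.jacquetModule t m (x : (t.restrict ρ).Coinvariants) = ((χ m : ℂˣ) : ℂ) • (x : (t.restrict ρ).Coinvariants) := by
    intro m
    have := congrArg Subtype.val (hχ m)
    rwa [hτ, Submodule.coe_smul] at this
  refine ⟨χ', ⟨(x : (t.restrict ρ).Coinvariants), hx0', fun m => ?_⟩, ?_⟩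
  · rw [normalizedJacquet_apply, hχ_apply, smul_smul]
    congr 1
    show _ = (((χ m * ((rootDeltaChar t.P)⁻¹.comp (Subgroup.inclusion t.M_le)) m) : ℂˣ) : ℂ)
    rw [Units.val_mul, MonoidHom.comp_apply, MonoidHom.inv_apply, mul_comm]
  · -- `δ^{1/2}(a) χ'(a) = χ(a) = c`
    have h1 : ((χ a' : ℂˣ) : ℂ) = c := by
      have h2 := hχ_apply a'
      rw [(hEmem x).1 hxE] at h2
      exact (smul_left_injective ℂ hx0' h2).symm
    rw [← h1]
    show ((rootDeltaChar t.P ⟨𝓘.a, t.M_le 𝓘.a_mem⟩ : ℂˣ) : ℂ) *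
        (((χ a' * ((rootDeltaChar t.P)⁻¹.comp (Subgroup.inclusion t.M_le)) a') : ℂˣ) : ℂ) = _
    rw [Units.val_mul, MonoidHom.comp_apply, MonoidHom.inv_apply, Units.val_inv_eq_inv_val, mul_left_comm,
      show Subgroup.inclusion t.M_le a' = ⟨𝓘.a, t.M_le 𝓘.a_mem⟩ from rfl, mul_inv_cancel₀ (Units.ne_zero _), mul_one]

/-- **EIGENVALUE OF `T_a` ⇒ EXPONENT, with the level (ED. 2)** (`M` abelian): as `exists_hasJacquetExponent_of_hasEigenvalue_heckeRayEnd`, recording moreover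
that the UNNORMALISED character `χ' · δ_P^{1/2}` is TRIVIAL on `K_n ∩ M` (its eigenvector lies in `V_N^{K_n ∩ M}`) — the input of the «`|χ(k)| = 1` on
compact torus elements» step of the `U(3)` assembly.  A NON-ZERO eigenvalue `c` of `T_a` on `V^{K_n}` is `δ_P(a)^{1/2} χ'(a)` for some exponent
`χ'` of `ρ`.  The class of an eigenvector is a `π_N(a)`-eigenvector in the finite-dimensional `[V^{K_n}]` (★ `fixedPointsMk_ne_zero_of_eigenvector`);
the `c`-eigenspace of `π_N(a)` there is `M`-stable (`M` abelian, `K_n ∩ M`-fixedness is preserved), so it contains a common eigenvector (§1).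
[cite: Casselman1995, §4.4 p. 45, Prop. 2.1.9] -/
theorem exists_hasJacquetExponent_of_hasEigenvalue_heckeRayEnd' (t : ParabolicTriple G) [LocallyCompactSpace ↥t.P] (𝓘 : t.IwahoriDatum)
    (hN : IsClosed (t.N : Set G)) (hρa : ρ.IsAdmissible) (hMc : ∀ a b : ↥t.M, a * b = b * a)
    (haN : ∀ n, ∀ x ∈ 𝓘.K n ⊓ t.N, 𝓘.a * x * 𝓘.a⁻¹ ∈ 𝓘.K n)
    (haNbar : ∀ n, ∀ x ∈ 𝓘.K n ⊓ 𝓘.Nbar, 𝓘.a⁻¹ * x * 𝓘.a ∈ 𝓘.K n ⊓ 𝓘.Nbar)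
    (hexh : ∀ n, ∀ x ∈ t.N, ∃ m : ℕ, ∀ m', m ≤ m' → 𝓘.a ^ m' * x * (𝓘.a ^ m')⁻¹ ∈ 𝓘.K n)
    (n : ℕ) {c : ℂ} (hc0 : c ≠ 0) (hc : Module.End.HasEigenvalue (ρ.heckeRayEnd (𝓘.isCompact_K n) hρa.1 𝓘.a) c) :
    ∃ χ' : ↥t.M →* ℂˣ, ρ.HasJacquetExponent t χ' ∧
      ((rootDeltaChar t.P ⟨𝓘.a, t.M_le 𝓘.a_mem⟩ : ℂˣ) : ℂ) * ((χ' ⟨𝓘.a, 𝓘.a_mem⟩ : ℂˣ) : ℂ) = c ∧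
      ∀ m : ↥t.M, (m : G) ∈ 𝓘.K n →
        ((χ' m : ℂˣ) : ℂ) * ((rootDeltaChar t.P (Subgroup.inclusion t.M_le m) : ℂˣ) : ℂ) = 1 := by
  classical
  obtain ⟨v, hv⟩ := hc.exists_hasEigenvector
  obtain ⟨hw0, hw⟩ := fixedPointsMk_ne_zero_of_eigenvector t (𝓘.isCompact_K n) (𝓘.isOpen_K n) hN hρa.1 (𝓘.factorization n)
    𝓘.a_mem (fun m hm => 𝓘.a_comm m (Subgroup.mem_inf.1 hm).2) (haN n) (haNbar n) (hexh n) hv.2 hc0 hv.apply_eq_smul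
  -- the finite-dimensional `[V^{K_n}]` and the `c`-eigenspace of `π_N(a)` in it
  haveI : FiniteDimensional ℂ (ρ.fixedPoints (𝓘.K n)) := finite_fixedPoints_of_isAdmissible hρa (𝓘.isCompact_K n) (𝓘.isOpen_K n)
  let R : Submodule ℂ (t.restrict ρ).Coinvariants := LinearMap.range (ρ.fixedPointsMk t (𝓘.K n))
  haveI : FiniteDimensional ℂ R := inferInstance
  set a' : ↥t.M := ⟨𝓘.a, 𝓘.a_mem⟩ with ha'
  -- work inside the finite-dimensional space `R` with the restricted action
  have hReq : R = (ρ.jacquetModule t).fixedPoints ((𝓘.K n).comap t.M.subtype) := range_fixedPointsMk_eq t 𝓘 hρa n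
  have hRinv : ∀ m : ↥t.M, ∀ x ∈ R, ρ.jacquetModule t m x ∈ R := by
    intro m x hx
    rw [hReq, mem_fixedPoints] at hx ⊢
    intro κ hκ
    rw [← Module.End.mul_apply, ← map_mul, hMc, map_mul, Module.End.mul_apply, hx κ hκ]
  let τ : Representation ℂ ↥t.M R :=
    { toFun := fun m => (ρ.jacquetModule t m).restrict (hRinv m)
      map_one' := by ext x; simp [LinearMap.restrict_apply]
      map_mul' := fun m m' => by ext x; simp [LinearMap.restrict_apply] }
  have hτ : ∀ (m : ↥t.M) (x : R), ((τ m x : R) : (t.restrict ρ).Coinvariants) = ρ.jacquetModule t m x := fun m x => rfl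
  let E : Submodule ℂ R :=
    { carrier := {x | ρ.jacquetModule t a' (x : (t.restrict ρ).Coinvariants) = c • (x : (t.restrict ρ).Coinvariants)}
      zero_mem' := by simp
      add_mem' := fun {x y} hx hy => by
        simp only [Set.mem_setOf_eq, Submodule.coe_add, map_add, smul_add] at hx hy ⊢; rw [hx, hy]
      smul_mem' := fun r {x} hx => by
        simp only [Set.mem_setOf_eq, Submodule.coe_smul, map_smul] at hx ⊢; rw [hx, smul_comm] }
  have hEmem : ∀ x : R, x ∈ E ↔ ρ.jacquetModule t a' (x : (t.restrict ρ).Coinvariants) = c • (x : (t.restrict ρ).Coinvariants) :=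
    fun x => Iff.rfl
  have hE : E ≠ ⊥ := by
    rw [Submodule.ne_bot_iff]
    refine ⟨⟨ρ.fixedPointsMk t (𝓘.K n) v, LinearMap.mem_range_self _ _⟩, (hEmem _).2 hw, fun h => hw0 ?_⟩
    exact congrArg Subtype.val h
  have hEinv : ∀ m : ↥t.M, ∀ x ∈ E, τ m x ∈ E := by
    intro m x hx
    rw [hEmem] at hx ⊢
    rw [hτ, ← Module.End.mul_apply, ← map_mul, hMc, map_mul, Module.End.mul_apply, hx, map_smul]
  obtain ⟨χ, x, hxE, hx0, hχ⟩ := exists_character_of_forall_mem_of_comm τ hMc E hE hEinv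
  -- the normalised character
  let χ' : ↥t.M →* ℂˣ := χ * ((rootDeltaChar t.P)⁻¹.comp (Subgroup.inclusion t.M_le))
  have hx0' : (x : (t.restrict ρ).Coinvariants) ≠ 0 := fun h => hx0 (Subtype.ext h)
  have hχ_apply : ∀ m : ↥t.M, ρ.jacquetModule t m (x : (t.restrict ρ).Coinvariants) = ((χ m : ℂˣ) : ℂ) • (x : (t.restrict ρ).Coinvariants) := by
    intro m
    have := congrArg Subtype.val (hχ m)
    rwa [hτ, Submodule.coe_smul] at this
  refine ⟨χ', ⟨(x : (t.restrict ρ).Coinvariants), hx0', fun m => ?_⟩, ?_, fun m hm => ?_⟩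
  · rw [normalizedJacquet_apply, hχ_apply, smul_smul]
    congr 1
    show _ = (((χ m * ((rootDeltaChar t.P)⁻¹.comp (Subgroup.inclusion t.M_le)) m) : ℂˣ) : ℂ)
    rw [Units.val_mul, MonoidHom.comp_apply, MonoidHom.inv_apply, mul_comm]
  · -- `δ^{1/2}(a) χ'(a) = χ(a) = c`
    have h1 : ((χ a' : ℂˣ) : ℂ) = c := by
      have h2 := hχ_apply a'
      rw [(hEmem x).1 hxE] at h2
      exact (smul_left_injective ℂ hx0' h2).symm
    rw [← h1]
    show ((rootDeltaChar t.P ⟨𝓘.a, t.M_le 𝓘.a_mem⟩ : ℂˣ) : ℂ) *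
        (((χ a' * ((rootDeltaChar t.P)⁻¹.comp (Subgroup.inclusion t.M_le)) a') : ℂˣ) : ℂ) = _
    rw [Units.val_mul, MonoidHom.comp_apply, MonoidHom.inv_apply, Units.val_inv_eq_inv_val, mul_left_comm,
      show Subgroup.inclusion t.M_le a' = ⟨𝓘.a, t.M_le 𝓘.a_mem⟩ from rfl, mul_inv_cancel₀ (Units.ne_zero _), mul_one]
  · -- `χ` is trivial on `K_n ∩ M`: `x ∈ V_N^{K_n ∩ M}`
    have hxfix : ρ.jacquetModule t m (x : (t.restrict ρ).Coinvariants) = (x : (t.restrict ρ).Coinvariants) := by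
      have hxR : (x : (t.restrict ρ).Coinvariants) ∈ (ρ.jacquetModule t).fixedPoints ((𝓘.K n).comap t.M.subtype) := by
        rw [← range_fixedPointsMk_eq t 𝓘 hρa n]
        exact x.2
      rw [mem_fixedPoints] at hxR
      exact hxR m (Subgroup.mem_comap.2 hm)
    have h1 : ((χ m : ℂˣ) : ℂ) = 1 := by
      have h2 := hχ_apply m
      rw [hxfix] at h2
      have h3 : ((χ m : ℂˣ) : ℂ) • (x : (t.restrict ρ).Coinvariants) = (1 : ℂ) • (x : (t.restrict ρ).Coinvariants) := by
        rw [one_smul]; exact h2.symm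
      exact smul_left_injective ℂ hx0' h3
    show (((χ m * ((rootDeltaChar t.P)⁻¹.comp (Subgroup.inclusion t.M_le)) m) : ℂˣ) : ℂ) * _ = 1
    rw [Units.val_mul, MonoidHom.comp_apply, MonoidHom.inv_apply, Units.val_inv_eq_inv_val, h1, one_mul,
      inv_mul_cancel₀ (Units.ne_zero _)]


end Exponents

end Representation
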